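import Literature.Computability.QuantumComplexity.RazTalBlocks
import Literature.Computability.Cryptography.ClassBQPProofs
import HarnessLib

/-!
# The Raz–Tal `BQP^O` machine, II: `m` blocks, the threshold, the family

Sequel of `RazTalBlocks.lean` (one run of the one-query Forrelation algorithm as a Clifford+T
circuit with an oracle gate, acceptance weight `blockAcc`). Here the `m = rtBlocks n` runs are
placed on pairwise disjoint blocks of wires, their accept bits (half selector `0`) are counted
by a reversible one-hot token register, and the threshold `rtThreshold n` is written on wire `0`
(Raz–Tal, J. ACM 69 (2022), App. A with Claim 8.1: "`Q₁` … accept iff `S ≥ mε/4`"):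

* global layout (`uW s c`: token registers, `blkBase i`: the blocks, `rtAnc`), the classical
  pre-processing `preOps` (clear wire `0`, start the token), the token steps `tokOps` and the
  read-out `postOps`, the whole program `allOps` and the circuit `bigCirc n` on `n + rtAnc n` wires;
* semantics: `clEval_preOps`, the token invariant (`TokInv`, `tokInv_step`,
  `clEval_postOps_zero : wire 0 = [rtThreshold n ≤ #accepting blocks]`), the block segment as
  embedded block circuits (`compileList_blocksOps`), the product state after the blocks
  (`CircuitEmbedding.prodState`), and
  **`acceptProb_bigCirc : acceptProb = q1Accept n (rtWindow A n)`** (the Born weights of the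
  product state form the product distribution of the independent runs, `sum_normSq_prodState_mul`,
  regrouped by the pattern of accepting runs, `q1Accept`);
* the hard-wired small circuits `smallCirc` (accept with probability `tbl n ∈ {0,1}`), the family
  `rtFamily n₀ tbl`, and **`razTal2022_bqpMachine_of_isUniform`**: the named fact
  `RazTal2022_bqpMachine` follows from the uniformity of `rtFamily` (proved in the sequel
  `RazTalMachineUniform.lean` by a generator program).

Namespace `Literature.QuantumAdvantage.RazTalMachine`, as in `RazTalBlocks.lean`.

## References

* R. Raz, A. Tal, *Oracle separation of BQP and PH*, J. ACM 69 (2022), App. A, Claim 8.1, §6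
  [RazTalJACM2022].
* S. Aaronson, A. Ambainis, *Forrelation*, STOC 2015 / SIAM J. Comput. 47 (2018), Prop. 6
  [AaronsonAmbainis2018].
* M. A. Nielsen, I. L. Chuang, *Quantum Computation and Quantum Information*, CUP 2010, §2.1.7
  eq. (2.45) (product operators act factorwise), §3.2.5 (reversible circuits from Toffoli gates
  and ancilla bits).
-/

noncomputable section

namespace Literature.Computability.QuantumComplexity

open _root_.Computability Complexity Cryptography Matrix Finset RevSim

namespace RazTalMachine

/-! ### Global layout -/

section GLayout

variable (n : ℕ)

/-- The number of index bits `L = size m`. [cite: RazTalJACM2022, App. A] -/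
abbrev rtL : ℕ := rtIdxBits n

/-- The size of a block. [cite: RazTalJACM2022, App. A] -/
abbrev rtB : ℕ := Bsz n (rtL n)

/-- Token wire `c` of token register `s` (`s ≤ m` registers of `m + 1` wires after the input, the
pad wire `n` and the junk wire `n + 1`). (cf. Nielsen–Chuang 2010, §3.2.5) [folklore] -/
def uW (s c : ℕ) : ℕ := n + 2 + s * (rtBlocks n + 1) + c

/-- The first wire of block `i`. [cite: RazTalJACM2022, App. A] -/
def blkBase (i : ℕ) : ℕ := n + 2 + (rtBlocks n + 1) * (rtBlocks n + 1) + i * rtB n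

/-- The half-selector wire of block `i` (its accept bit is `0` there). [cite: RazTalJACM2022, §2.2] -/
def hGlob (i : ℕ) : ℕ := blkBase n i + hW n

/-- The number of ancillas: pad, junk, `(m+1)²` token wires, `m` blocks. [cite: RazTalJACM2022, App. A] -/
def rtAnc : ℕ := 2 + (rtBlocks n + 1) * (rtBlocks n + 1) + rtBlocks n * rtB n

/-- The number of wires. [folklore] -/
abbrev rtW : ℕ := n + rtAnc n

variable {n}

/-- The end of the blocks is the number of wires. [folklore] -/
theorem blkBase_rtBlocks : blkBase n (rtBlocks n) = rtW n := by unfold blkBase rtW rtAnc; ring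

/-- The blocks follow each other. [folklore] -/
theorem blkBase_eq (i : ℕ) : blkBase n i = blkBase n 0 + i * rtB n := by unfold blkBase; ring

/-- The first block starts below the number of wires. [folklore] -/
theorem blkBase_zero_le_rtW : blkBase n 0 ≤ rtW n := by
  rw [← blkBase_rtBlocks, blkBase_eq (rtBlocks n)]; exact Nat.le_add_right _ _


/-- Token wires are below the blocks. [folklore] -/
theorem uW_lt_blkBase {s c : ℕ} (hs : s ≤ rtBlocks n) (hc : c ≤ rtBlocks n) (i : ℕ) : uW n s c < blkBase n i := by
  unfold uW blkBase
  have : s * (rtBlocks n + 1) + c < (rtBlocks n + 1) * (rtBlocks n + 1) := by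
    calc s * (rtBlocks n + 1) + c < s * (rtBlocks n + 1) + (rtBlocks n + 1) := by omega
      _ = (s + 1) * (rtBlocks n + 1) := by ring
      _ ≤ (rtBlocks n + 1) * (rtBlocks n + 1) := Nat.mul_le_mul_right _ (by omega)
  omega

/-- Token wires are below the number of wires. [folklore] -/
theorem uW_lt_rtW {s c : ℕ} (hs : s ≤ rtBlocks n) (hc : c ≤ rtBlocks n) : uW n s c < rtW n :=
  lt_of_lt_of_le (uW_lt_blkBase hs hc 0) blkBase_zero_le_rtW

/-- Token wires are injective in (register, position). [folklore] -/
theorem uW_inj {s c s' c' : ℕ} (hc : c ≤ rtBlocks n) (hc' : c' ≤ rtBlocks n) (h : uW n s c = uW n s' c') :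
    s = s' ∧ c = c' := by
  unfold uW at h
  have h1 : s * (rtBlocks n + 1) + c = s' * (rtBlocks n + 1) + c' := by omega
  have hs : s = s' := by nlinarith
  subst hs
  exact ⟨rfl, by omega⟩

/-- Wires of block `i < m` are below `rtW`. [folklore] -/
theorem blkBase_add_lt {i p : ℕ} (hi : i < rtBlocks n) (hp : p < rtB n) : blkBase n i + p < rtW n := by
  rw [← blkBase_rtBlocks]
  unfold blkBase
  have : i * rtB n + p < rtBlocks n * rtB n := by
    calc i * rtB n + p < i * rtB n + rtB n := by omega
      _ = (i + 1) * rtB n := by ring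
      _ ≤ rtBlocks n * rtB n := Nat.mul_le_mul_right _ hi
  omega

/-- Blocks are disjoint: equal wires have equal block and offset. [folklore] -/
theorem blkBase_add_inj {i p j q : ℕ} (hp : p < rtB n) (hq : q < rtB n) (h : blkBase n i + p = blkBase n j + q) :
    i = j ∧ p = q := by
  unfold blkBase at h
  have h1 : i * rtB n + p = j * rtB n + q := by omega
  have hi : i = j := by nlinarith
  subst hi
  exact ⟨rfl, by omega⟩

/-- Token wires are `≥ n + 2`. [folklore] -/
theorem le_uW (s c : ℕ) : n + 2 ≤ uW n s c := by unfold uW; omega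

/-- Block wires are `≥ n + 2`. [folklore] -/
theorem le_blkBase (i : ℕ) : n + 2 ≤ blkBase n i := by unfold blkBase; omega

/-- The threshold fits in a token register: `rtThreshold n ≤ m + 1`. [cite: RazTalJACM2022, Claim 8.1] -/
theorem rtThreshold_le : rtThreshold n ≤ rtBlocks n + 1 := by
  unfold rtThreshold rtBlocks
  rcases Nat.eq_zero_or_pos n with rfl | hn
  · simp
  · have : n ^ 2 ≤ n ^ 3 := Nat.pow_le_pow_right hn (by norm_num)
    omega

/-- There is at least one wire. [folklore] -/
theorem rtW_pos : 0 < rtW n := by unfold rtW rtAnc; omega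

end GLayout

/-! ### The program -/

section GProgram

variable (n : ℕ)

/-- **Pre-processing**: move the content of wire `0` to the junk wire `n + 1` (two `CNOT`s; this
clears wire `0`, which is input bit `x₀` for `n ≥ 1` and the pad ancilla for `n = 0`), and start
the token at position `0` of register `0`. [folklore] -/
def preOps : List (ClOp ℕ) := [ClOp.cnot 0 (n + 1), ClOp.cnot (n + 1) 0, ClOp.not (uW n 0 0)]

/-- One token-passing group: if the token of register `i` is at `c`, copy it to register `i + 1`
at `c` if block `i` rejects (half selector `1`) and at `c + 1` if it accepts (half selector `0`);
the half selector is flipped and restored. (cf. Nielsen–Chuang 2010, §3.2.5) [folklore] -/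
def tokGroup (i c : ℕ) : List (ClOp ℕ) :=
  [ClOp.toffoli (uW n i c) (hGlob n i) (uW n (i + 1) c), ClOp.not (hGlob n i),
    ClOp.toffoli (uW n i c) (hGlob n i) (uW n (i + 1) (c + 1)), ClOp.not (hGlob n i)]

/-- The token step of block `i`: one group per position `c < m`. (cf. Nielsen–Chuang 2010, §3.2.5) [folklore] -/
def tokOps (i : ℕ) : List (ClOp ℕ) := (List.range (rtBlocks n)).flatMap (tokGroup n i)

/-- **Post-processing**: the `m` token steps (so that register `m` holds the number of accepting
blocks, one-hot), then wire `0 ← 1 ⊕ ⨁_{c < thr} token_m(c) = [thr ≤ #accepting]`. [cite: RazTalJACM2022, Claim 8.1] -/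
def postOps : List (ClOp ℕ) :=
  (List.range (rtBlocks n)).flatMap (tokOps n) ++
    (ClOp.not 0 :: (List.range (rtThreshold n)).map fun c => ClOp.cnot (uW n (rtBlocks n) c) 0)

/-- **The blocks**: block `i` is the block program of `RazTalBlocks` shifted to its wires. [cite: RazTalJACM2022, App. A] -/
def blocksOps : List (RtOp ℕ) :=
  (List.range (rtBlocks n)).flatMap fun i => (blockOps n (rtL n) i).map (RtOp.map (· + blkBase n i))

/-- **The whole program at input length `n`.** [cite: RazTalJACM2022, App. A] -/
def allOps : List (RtOp ℕ) := (preOps n).map RtOp.cl ++ (blocksOps n ++ (postOps n).map RtOp.cl)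

variable {n}

/-- The pre-processing is well formed. [folklore] -/
theorem preOps_wf : ∀ op ∈ preOps n, op.WF := by
  intro op hop
  simp only [preOps, List.mem_cons, List.not_mem_nil, or_false] at hop
  rcases hop with rfl | rfl | rfl
  · change (0 : ℕ) ≠ n + 1; omega
  · change n + 1 ≠ 0; omega
  · trivial

/-- The wires of the pre-processing. [folklore] -/
theorem preOps_lt : ∀ op ∈ preOps n, ∀ w ∈ wiresOf op, w < rtW n := by
  intro op hop w hw
  simp only [preOps, List.mem_cons, List.not_mem_nil, or_false] at hop
  have hu := uW_lt_blkBase (n := n) (Nat.zero_le _) (Nat.zero_le _) (rtBlocks n)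
  rw [blkBase_rtBlocks] at hu
  rcases hop with rfl | rfl | rfl <;>
    simp only [mem_wiresOf, ClOp.target, ClOp.controls, List.mem_singleton, List.not_mem_nil, or_false] at hw <;>
    rcases hw with rfl | rfl <;> first | omega | (unfold rtW rtAnc; omega)

/-- The wires of a token group. [folklore] -/
theorem tokGroup_wires {i c : ℕ} {op : ClOp ℕ} (hop : op ∈ tokGroup n i c) {w : ℕ} (hw : w ∈ wiresOf op) :
    w = uW n i c ∨ w = hGlob n i ∨ w = uW n (i + 1) c ∨ w = uW n (i + 1) (c + 1) := by
  simp only [tokGroup, List.mem_cons, List.not_mem_nil, or_false] at hop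
  rcases hop with rfl | rfl | rfl | rfl <;>
    simp only [mem_wiresOf, ClOp.target, ClOp.controls, List.mem_cons, List.not_mem_nil, or_false] at hw <;> tauto

/-- The half selectors are block wires. [folklore] -/
theorem hGlob_lt {i : ℕ} (hi : i < rtBlocks n) : hGlob n i < rtW n :=
  blkBase_add_lt hi (by unfold rtB hW Bsz; omega)

/-- A half selector is not a token wire. [folklore] -/
theorem uW_ne_hGlob {s c : ℕ} (hs : s ≤ rtBlocks n) (hc : c ≤ rtBlocks n) (i : ℕ) : uW n s c ≠ hGlob n i :=
  (lt_of_lt_of_le (uW_lt_blkBase hs hc i) (Nat.le_add_right _ _)).ne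

/-- Token groups are well formed. [folklore] -/
theorem tokGroup_wf {i c : ℕ} (hi : i < rtBlocks n) (hc : c < rtBlocks n) : ∀ op ∈ tokGroup n i c, op.WF := by
  intro op hop
  simp only [tokGroup, List.mem_cons, List.not_mem_nil, or_false] at hop
  rcases hop with rfl | rfl | rfl | rfl
  · refine ⟨uW_ne_hGlob hi.le hc.le i, fun h => ?_, (uW_ne_hGlob (by omega) hc.le i).symm⟩
    have := (uW_inj hc.le hc.le h).1; omega
  · trivial
  · refine ⟨uW_ne_hGlob hi.le hc.le i, fun h => ?_, (uW_ne_hGlob (by omega) (by omega) i).symm⟩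
    have := (uW_inj hc.le (by omega) h).1; omega
  · trivial

/-- The post-processing is well formed. [folklore] -/
theorem postOps_wf : ∀ op ∈ postOps n, op.WF := by
  intro op hop
  simp only [postOps, List.mem_append, List.mem_flatMap, List.mem_range, List.mem_cons, List.mem_map, tokOps] at hop
  rcases hop with ⟨i, hi, c, hc, hop⟩ | rfl | ⟨c, hc, rfl⟩
  · exact tokGroup_wf hi hc op hop
  · trivial
  · change uW n (rtBlocks n) c ≠ 0; unfold uW; omega

/-- The wires of the post-processing. [folklore] -/
theorem postOps_lt : ∀ op ∈ postOps n, ∀ w ∈ wiresOf op, w < rtW n := by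
  intro op hop w hw
  have hr := rtW_pos (n := n)
  simp only [postOps, List.mem_append, List.mem_flatMap, List.mem_range, List.mem_cons, List.mem_map, tokOps] at hop
  rcases hop with ⟨i, hi, c, hc, hop⟩ | rfl | ⟨c, hc, rfl⟩
  · have hb := blkBase_rtBlocks (n := n)
    rcases tokGroup_wires hop hw with rfl | rfl | rfl | rfl
    · have := uW_lt_blkBase (n := n) hi.le hc.le (rtBlocks n); omega
    · exact hGlob_lt hi
    · have := uW_lt_blkBase (n := n) (by omega : i + 1 ≤ rtBlocks n) hc.le (rtBlocks n); omega
    · have := uW_lt_blkBase (n := n) (by omega : i + 1 ≤ rtBlocks n) (by omega : c + 1 ≤ rtBlocks n) (rtBlocks n); omega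
  · simp only [mem_wiresOf, ClOp.target, ClOp.controls, List.not_mem_nil, or_false] at hw
    rw [hw]; exact hr
  · simp only [mem_wiresOf, ClOp.target, ClOp.controls, List.mem_singleton] at hw
    have hthr := rtThreshold_le (n := n)
    rcases hw with rfl | rfl
    · exact hr
    · have := uW_lt_blkBase (n := n) le_rfl (by omega : c ≤ rtBlocks n) (rtBlocks n)
      rw [blkBase_rtBlocks] at this; exact this

/-- Shifting preserves well-formedness. [folklore] -/
theorem RtOp.WF.map_add {op : RtOp ℕ} (h : op.WF) (b : ℕ) : (op.map (· + b)).WF :=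
  h.map_of_injOn fun _ _ _ _ e => Nat.add_right_cancel e

/-- The blocks are well formed. [folklore] -/
theorem blocksOps_wf : ∀ op ∈ blocksOps n, op.WF := by
  intro op hop
  simp only [blocksOps, List.mem_flatMap, List.mem_range, List.mem_map] at hop
  obtain ⟨i, -, op, hop, rfl⟩ := hop
  exact (blockOps_wf i op hop).map_add _

/-- The wires of the blocks. [folklore] -/
theorem blocksOps_lt : ∀ op ∈ blocksOps n, ∀ w ∈ op.wires, w < rtW n := by
  intro op hop w hw
  simp only [blocksOps, List.mem_flatMap, List.mem_range, List.mem_map] at hop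
  obtain ⟨i, hi, op', hop', rfl⟩ := hop
  rw [RtOp.wires_map] at hw
  obtain ⟨w', hw', rfl⟩ := List.mem_map.1 hw
  rw [add_comm]
  exact blkBase_add_lt hi (blockOps_lt hi.le op' hop' w' hw')

/-- The whole program is well formed. [folklore] -/
theorem allOps_wf : ∀ op ∈ allOps n, op.WF := by
  intro op hop
  simp only [allOps, List.mem_append, List.mem_map] at hop
  rcases hop with ⟨op, hop, rfl⟩ | hop | ⟨op, hop, rfl⟩
  · exact preOps_wf op hop
  · exact blocksOps_wf op hop
  · exact postOps_wf op hop

/-- The wires of the whole program are below `rtW`. [folklore] -/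
theorem allOps_lt : ∀ op ∈ allOps n, ∀ w ∈ op.wires, w < rtW n := by
  intro op hop
  simp only [allOps, List.mem_append, List.mem_map] at hop
  rcases hop with ⟨op, hop, rfl⟩ | hop | ⟨op, hop, rfl⟩
  · exact preOps_lt op hop
  · exact blocksOps_lt op hop
  · exact postOps_lt op hop

variable (n)

/-- Wires of the whole register through `finOf`. [folklore] -/
def foW : ℕ → Fin (rtW n) := finOf (rtW n) rtW_pos

/-- **The circuit of the Raz–Tal machine at input length `n`** (for `n ≥ n₀`): pre-processing,
the `m` one-query blocks, the token count and the threshold read-out, compiled to Clifford+T with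
oracle gates. [cite: RazTalJACM2022, App. A] -/
def bigCirc : QCircuit cliffordT (rtW n) :=
  ⟨RtOp.compileList ((allOps n).map (RtOp.map (foW n))) (wf_map_finOf_of rtW_pos allOps_wf allOps_lt)⟩

end GProgram

/-! ### Semantics of the pre-processing -/

section Pre

variable {n : ℕ}

/-- **The pre-processing on an assignment vanishing from wire `n` on**: wire `0` is cleared, the
junk wire receives the old wire `0`, the token starts, nothing else changes. [folklore] -/
theorem clEval_preOps (w : ℕ → Bool) (hw : ∀ p, n ≤ p → w p = false) (p : ℕ) :
    clEval (preOps n) w p =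
      if p = 0 then false else if p = n + 1 then w 0 else if p = uW n 0 0 then true else w p := by
  have hu : n + 2 ≤ uW n 0 0 := le_uW 0 0
  have hn1 : w (n + 1) = false := hw _ (by omega)
  simp only [preOps, clEval_cons, clEval_nil, ClOp.eval_cnot, ClOp.eval_not]
  by_cases hp0 : p = 0
  · subst hp0
    rw [if_pos rfl, Function.update_of_ne (by omega), Function.update_self, Function.update_of_ne (by omega),
      Function.update_self, hn1]
    cases w 0 <;> rfl
  rw [if_neg hp0]
  by_cases hp1 : p = n + 1
  · subst hp1
    rw [if_pos rfl, Function.update_of_ne (by omega), Function.update_of_ne (by omega), Function.update_self, hn1,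
      Bool.false_xor]
  rw [if_neg hp1]
  by_cases hp2 : p = uW n 0 0
  · subst hp2
    rw [if_pos rfl, Function.update_self, Function.update_of_ne (by omega), Function.update_of_ne (by omega),
      hw _ (by omega)]
    rfl
  · rw [if_neg hp2, Function.update_of_ne hp2, Function.update_of_ne hp0, Function.update_of_ne hp1]

end Pre

/-! ### Semantics of the post-processing: the token count -/

section Post

variable {n : ℕ}

/-- The number of accepting blocks (half selector `0`) among the first `k`. [cite: RazTalJACM2022, Claim 8.1] -/
def cnt (w : ℕ → Bool) (k : ℕ) : ℕ := ((Finset.range k).filter fun i => w (hGlob n i) = false).card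

/-- `cnt` of one more block. [folklore] -/
theorem cnt_succ (w : ℕ → Bool) (k : ℕ) :
    cnt (n := n) w (k + 1) = cnt (n := n) w k + (if w (hGlob n k) = false then 1 else 0) := by
  unfold cnt
  rw [Finset.range_add_one, Finset.filter_insert]
  split
  · rw [Finset.card_insert_of_notMem (by simp)]
  · rfl

/-- `cnt w k ≤ k`. [folklore] -/
theorem cnt_le (w : ℕ → Bool) (k : ℕ) : cnt (n := n) w k ≤ k :=
  (Finset.card_filter_le _ _).trans (by simp)

/-- **The token invariant after `k` steps** (relative to the initial assignment `w`). (cf. Nielsen–Chuang 2010, §3.2.5) [folklore] -/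
structure TokInv (n k : ℕ) (w w' : ℕ → Bool) : Prop where
  /-- the half selectors are intact -/
  hsel : ∀ i, w' (hGlob n i) = w (hGlob n i)
  /-- register `k` holds the count of accepting blocks among the first `k`, one-hot -/
  onehot : ∀ c, c ≤ rtBlocks n → w' (uW n k c) = decide (c = cnt (n := n) w k)
  /-- the later registers are fresh -/
  fresh : ∀ s c, k < s → s ≤ rtBlocks n → c ≤ rtBlocks n → w' (uW n s c) = false
  /-- wire `0` is intact -/
  zero : w' 0 = w 0

/-- **One token group.** (cf. Nielsen–Chuang 2010, §3.2.5) [folklore] -/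
theorem clEval_tokGroup {i c : ℕ} (hi : i < rtBlocks n) (hc : c < rtBlocks n) (w : ℕ → Bool) :
    clEval (tokGroup n i c) w =
      if w (uW n i c) then
        Function.update (Function.update w (uW n (i + 1) c) (w (uW n (i + 1) c) ^^ w (hGlob n i)))
          (uW n (i + 1) (c + 1)) (w (uW n (i + 1) (c + 1)) ^^ !w (hGlob n i))
      else w := by
  have h1 : uW n (i + 1) c ≠ hGlob n i := uW_ne_hGlob (by omega) hc.le i
  have h2 : uW n (i + 1) (c + 1) ≠ hGlob n i := uW_ne_hGlob (by omega) (by omega) i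
  have h3 : uW n i c ≠ hGlob n i := uW_ne_hGlob hi.le hc.le i
  have h4 : uW n (i + 1) c ≠ uW n i c := fun h => by have := (uW_inj hc.le hc.le h).1; omega
  have h5 : uW n (i + 1) (c + 1) ≠ uW n i c := fun h => by have := (uW_inj (by omega) hc.le h).1; omega
  have h6 : uW n (i + 1) (c + 1) ≠ uW n (i + 1) c := fun h => by have := (uW_inj (by omega) hc.le h).2; omega
  simp only [tokGroup, clEval_cons, clEval_nil, ClOp.eval_toffoli, ClOp.eval_not]
  -- the values read by the four operations
  simp only [Function.update_self, Function.update_of_ne h1.symm, Function.update_of_ne h2,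
    Function.update_of_ne h2.symm, Function.update_of_ne h6, Function.update_of_ne h3, Function.update_of_ne h4.symm,
    Bool.not_not]
  -- the two flips of the half selector cancel
  rw [Function.update_comm h2.symm, Function.update_idem]
  have hH : Function.update (Function.update w (uW n (i + 1) c) (w (uW n (i + 1) c) ^^ (w (uW n i c) && w (hGlob n i))))
      (uW n (i + 1) (c + 1)) (w (uW n (i + 1) (c + 1)) ^^ (w (uW n i c) && !w (hGlob n i))) (hGlob n i) = w (hGlob n i) := by
    rw [Function.update_of_ne h2.symm, Function.update_of_ne h1.symm]
  rw [Function.update_eq_self_iff.2 hH.symm]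
  cases w (uW n i c)
  · simp
  · simp

/-- **One token step.** (cf. Nielsen–Chuang 2010, §3.2.5) [folklore] -/
theorem tokInv_step {k : ℕ} (hk : k < rtBlocks n) {w w' : ℕ → Bool} (hw : TokInv n k w w') :
    TokInv n (k + 1) w (clEval (tokOps n k) w') := by
  set p := cnt (n := n) w k with hp
  have hpk : p ≤ k := cnt_le w k
  -- invariant along the groups `c = 0, …, C - 1`
  have key : ∀ C, C ≤ rtBlocks n → ∀ q,
      clEval ((List.range C).flatMap (tokGroup n k)) w' q =
        if q = uW n (k + 1) p ∧ p < C then w (hGlob n k)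
        else if q = uW n (k + 1) (p + 1) ∧ p < C then !w (hGlob n k) else w' q := by
    intro C hC
    induction C with
    | zero => intro q; simp
    | succ C ih =>
      intro q
      have hC' : C ≤ rtBlocks n := by omega
      rw [List.range_succ, List.flatMap_append, clEval_append, List.flatMap_singleton,
        clEval_tokGroup hk (by omega)]
      -- the state before group `C`
      have hu : clEval ((List.range C).flatMap (tokGroup n k)) w' (uW n k C) = decide (C = p) := by
        rw [ih hC', if_neg, if_neg, hw.onehot C hC']
        · rintro ⟨h, -⟩; have := (uW_inj (by omega) (by omega) h).1; omega
        · rintro ⟨h, -⟩; have := (uW_inj (by omega) (by omega) h).1; omega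
      rw [hu]
      by_cases hCp : C = p
      · -- the token is here: the group fires
        subst hCp
        have hsel : clEval ((List.range (cnt (n := n) w k)).flatMap (tokGroup n k)) w' (hGlob n k) = w (hGlob n k) := by
          rw [ih hC', if_neg, if_neg, hw.hsel]
          · rintro ⟨h, -⟩; exact uW_ne_hGlob (by omega) (by omega) k h.symm
          · rintro ⟨h, -⟩; exact uW_ne_hGlob (by omega) hC' k h.symm
        have hz1 : clEval ((List.range (cnt (n := n) w k)).flatMap (tokGroup n k)) w' (uW n (k + 1) (cnt (n := n) w k)) = false := by
          rw [ih hC', if_neg (fun h => by omega), if_neg, hw.fresh (k + 1) _ (by omega) (by omega) hC']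
          rintro ⟨h, -⟩; have := (uW_inj hC' (by omega) h).2; omega
        have hz2 : clEval ((List.range (cnt (n := n) w k)).flatMap (tokGroup n k)) w' (uW n (k + 1) (cnt (n := n) w k + 1)) = false := by
          rw [ih hC', if_neg, if_neg (fun h => by omega), hw.fresh (k + 1) _ (by omega) (by omega) (by omega)]
          rintro ⟨h, -⟩; have := (uW_inj (by omega) hC' h).2; omega
        simp only [decide_true, if_true]
        rw [hsel, hz1, hz2, Bool.false_xor, Bool.false_xor]
        simp only [Function.update_apply]
        by_cases hq1 : q = uW n (k + 1) (cnt (n := n) w k + 1)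
        · subst hq1
          rw [if_pos rfl, if_neg, if_pos ⟨rfl, by omega⟩]
          rintro ⟨h, -⟩; have := (uW_inj (by omega) hC' h).2; omega
        · rw [if_neg hq1]
          by_cases hq2 : q = uW n (k + 1) (cnt (n := n) w k)
          · subst hq2; rw [if_pos rfl, if_pos ⟨rfl, by omega⟩]
          · rw [if_neg hq2, ih hC', if_neg (fun h => hq2 h.1), if_neg (fun h => hq1 h.1), if_neg (fun h => hq2 h.1),
              if_neg (fun h => hq1 h.1)]
      · simp only [hCp, decide_false, Bool.false_eq_true, ↓reduceIte]
        rw [ih hC']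
        have e : (p < C + 1) = (p < C) := propext ⟨fun h => by omega, fun h => by omega⟩
        simp only [e]
  have hfin := key (rtBlocks n) le_rfl
  have hpm : p < rtBlocks n := lt_of_le_of_lt hpk hk
  refine ⟨fun i => ?_, fun c hc => ?_, fun s c hs hsm hcm => ?_, ?_⟩
  · rw [tokOps, hfin, if_neg, if_neg, hw.hsel]
    · rintro ⟨h, -⟩; exact uW_ne_hGlob (by omega) (by omega) i h.symm
    · rintro ⟨h, -⟩; exact uW_ne_hGlob (by omega) hpm.le i h.symm
  · rw [tokOps, hfin, cnt_succ, ← hp]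
    by_cases hc1 : c = p
    · subst hc1
      rw [if_pos ⟨rfl, hpm⟩]
      cases w (hGlob n k) <;> simp
    · rw [if_neg (fun h => hc1 (uW_inj hc hpm.le h.1).2)]
      by_cases hc2 : c = p + 1
      · subst hc2
        rw [if_pos ⟨rfl, hpm⟩]
        cases w (hGlob n k) <;> simp
      · rw [if_neg (fun h => hc2 (uW_inj hc (by omega) h.1).2), hw.fresh (k + 1) c (by omega) (by omega) hc]
        symm; rw [decide_eq_false_iff_not]
        split <;> omega
  · rw [tokOps, hfin, if_neg, if_neg, hw.fresh s c (by omega) hsm hcm]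
    · rintro ⟨h, -⟩; have := (uW_inj hcm (by omega) h).1; omega
    · rintro ⟨h, -⟩; have := (uW_inj hcm hpm.le h).1; omega
  · rw [tokOps, hfin, if_neg, if_neg, hw.zero]
    · rintro ⟨h, -⟩; have := le_uW (n := n) (k + 1) (p + 1); omega
    · rintro ⟨h, -⟩; have := le_uW (n := n) (k + 1) p; omega

/-- The token invariant at the start. [folklore] -/
theorem tokInv_zero {w : ℕ → Bool} (h0 : w (uW n 0 0) = true)
    (hfresh : ∀ s c, s ≤ rtBlocks n → c ≤ rtBlocks n → (s, c) ≠ (0, 0) → w (uW n s c) = false) : TokInv n 0 w w := by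
  refine ⟨fun _ => rfl, fun c hc => ?_, fun s c hs hsm hcm => hfresh s c hsm hcm (by simp; omega), rfl⟩
  rcases Nat.eq_zero_or_pos c with rfl | hc0
  · rw [h0]; simp [cnt]
  · rw [hfresh 0 c (Nat.zero_le _) hc (by simp; omega)]; simp [cnt]; omega

/-- **All token steps**: register `m` holds the number of accepting blocks, one-hot. [cite: RazTalJACM2022, Claim 8.1] -/
theorem tokInv_all {w : ℕ → Bool} (h0 : w (uW n 0 0) = true)
    (hfresh : ∀ s c, s ≤ rtBlocks n → c ≤ rtBlocks n → (s, c) ≠ (0, 0) → w (uW n s c) = false) :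
    ∀ k, k ≤ rtBlocks n → TokInv n k w (clEval ((List.range k).flatMap (tokOps n)) w)
  | 0, _ => by simpa using tokInv_zero h0 hfresh
  | k + 1, hk => by
    rw [List.range_succ, List.flatMap_append, clEval_append, List.flatMap_singleton]
    exact tokInv_step (by omega) (tokInv_all h0 hfresh k (by omega))

/-- XOR of a one-hot family over an initial segment. [folklore] -/
theorem foldr_xor_onehot (p t : ℕ) :
    ((List.range t).map fun c => decide (c = p)).foldr Bool.xor false = decide (p < t) := by
  by_cases hpt : p < t
  · rw [foldr_xor_map_of_unique List.nodup_range (List.mem_range.2 hpt) _ (fun a _ ha => by simp [ha])]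
    simp [hpt]
  · rw [foldr_xor_map_eq_false _ (fun a ha => by rw [List.mem_range] at ha; simp; omega)]
    simp [hpt]

/-- **The post-processing writes the threshold bit on wire `0`**: for an assignment with wire `0`
clear, the token started and the other token wires fresh, wire `0` ends up holding
`[rtThreshold n ≤ #{i < m : half selector of block i = 0}]`. [cite: RazTalJACM2022, Claim 8.1 ("accept iff S ≥ mε/4")] -/
theorem clEval_postOps_zero (w : ℕ → Bool) (hz : w 0 = false) (h0 : w (uW n 0 0) = true)
    (hfresh : ∀ s c, s ≤ rtBlocks n → c ≤ rtBlocks n → (s, c) ≠ (0, 0) → w (uW n s c) = false) :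
    clEval (postOps n) w 0 = decide (rtThreshold n ≤ cnt (n := n) w (rtBlocks n)) := by
  have hT := tokInv_all h0 hfresh (rtBlocks n) le_rfl
  set w₁ := clEval ((List.range (rtBlocks n)).flatMap (tokOps n)) w with hw₁
  rw [postOps, clEval_append, ← hw₁, clEval_cons]
  set w₂ := (ClOp.not 0).eval w₁ with hw₂
  have h2z : w₂ 0 = true := by rw [hw₂, ClOp.eval_not, Function.update_self, hT.zero, hz]; rfl
  have h2u : ∀ c, c ≤ rtBlocks n → w₂ (uW n (rtBlocks n) c) = decide (c = cnt (n := n) w (rtBlocks n)) := fun c hc => by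
    rw [hw₂, ClOp.eval_not, Function.update_of_ne (by have := le_uW (n := n) (rtBlocks n) c; omega), hT.onehot c hc]
  set ops := (List.range (rtThreshold n)).map (fun c => ClOp.cnot (uW n (rtBlocks n) c) 0) with hops
  have hdisj : ∀ op ∈ ops, ∀ op' ∈ ops, op'.target ∉ op.controls := by
    intro op hop op' hop'
    simp only [hops, List.mem_map, List.mem_range] at hop hop'
    obtain ⟨c, -, rfl⟩ := hop; obtain ⟨c', -, rfl⟩ := hop'
    simp only [ClOp.target, ClOp.controls, List.mem_singleton]
    have := le_uW (n := n) (rtBlocks n) c; omega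
  rw [clEval_apply_of_disjoint ops hdisj, h2z, Bool.true_xor, clToggle, hops, List.map_map]
  have e : (fun c => decide ((ClOp.cnot (uW n (rtBlocks n) c) 0).target = 0) && (ClOp.cnot (uW n (rtBlocks n) c) 0).guard w₂) ∘
      (fun c => c) = fun c => decide ((ClOp.cnot (uW n (rtBlocks n) c) 0).target = 0) && (ClOp.cnot (uW n (rtBlocks n) c) 0).guard w₂ := rfl
  have hthr := rtThreshold_le (n := n)
  have e2 : ((List.range (rtThreshold n)).map ((fun op : ClOp ℕ => decide (op.target = 0) && op.guard w₂) ∘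
      fun c => ClOp.cnot (uW n (rtBlocks n) c) 0)) =
      (List.range (rtThreshold n)).map fun c => decide (c = cnt (n := n) w (rtBlocks n)) := by
    refine List.map_congr_left fun c hc => ?_
    rw [List.mem_range] at hc
    simp only [Function.comp_apply, ClOp.target, ClOp.guard, decide_true, Bool.true_and]
    exact h2u c (by omega)
  rw [e2, foldr_xor_onehot]
  by_cases h : rtThreshold n ≤ cnt (n := n) w (rtBlocks n)
  · simp [h, not_lt.2 h]
  · simp [h, lt_of_not_ge h]

end Post


/-! ### The blocks as embedded block circuits -/

section Blocks

variable {n : ℕ}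

/-- `List.range` as a map of `List.finRange`. [folklore] -/
theorem range_eq_map_finRange (k : ℕ) : List.range k = (List.finRange k).map fun j : Fin k => j.val := by
  conv_lhs => rw [← List.map_id (List.range k)]
  exact map_range_eq_map_finRange k id

variable (n)

/-- The wires of block `i` as an embedding `Fin (rtB n) ↪ Fin (rtW n)`. [cite: RazTalJACM2022, App. A] -/
def blkEmb (i : Fin (rtBlocks n)) : Fin (rtB n) ↪ Fin (rtW n) :=
  ⟨fun p => ⟨blkBase n i + p, blkBase_add_lt i.isLt p.isLt⟩, fun p q h => by
    have : blkBase n i + p = blkBase n i + q := congrArg Fin.val h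
    exact Fin.ext (by omega)⟩

variable {n}

/-- The value of a block wire. [folklore] -/
@[simp] theorem val_blkEmb (i : Fin (rtBlocks n)) (p : Fin (rtB n)) : (blkEmb n i p : ℕ) = blkBase n i + p := rfl

/-- **The blocks are pairwise disjoint.** [folklore] -/
theorem blockDisjoint_blkEmb : BlockDisjoint (blkEmb n) := by
  intro i j hij
  rw [Set.disjoint_left]
  rintro w ⟨p, rfl⟩ ⟨q, hq⟩
  have := congrArg Fin.val hq
  simp only [val_blkEmb] at this
  exact hij (Fin.ext (blkBase_add_inj q.isLt p.isLt this).1).symm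

/-- Off-block wires are the wires below the first block. [folklore] -/
theorem offBlocks_iff (w : Fin (rtW n)) : OffBlocks (blkEmb n) w ↔ (w : ℕ) < blkBase n 0 := by
  constructor
  · intro h
    by_contra hlt
    push Not at hlt
    -- `w` lies in the block `i = (w - blkBase 0) / B`, position `(w - blkBase 0) % B`
    have hB : 0 < rtB n := Bsz_pos _ _
    have hw : (w : ℕ) < n + rtAnc n := w.isLt
    have he : blkBase n (rtBlocks n) = n + rtAnc n := blkBase_rtBlocks
    have he' := blkBase_eq (n := n) (rtBlocks n)
    set d := (w : ℕ) - blkBase n 0 with hd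
    have hdlt : d < rtBlocks n * rtB n := by omega
    have hi : d / rtB n < rtBlocks n := (Nat.div_lt_iff_lt_mul hB).2 hdlt
    apply h ⟨d / rtB n, hi⟩ ⟨⟨d % rtB n, Nat.mod_lt _ hB⟩, Fin.ext ?_⟩
    simp only [val_blkEmb]
    rw [blkBase_eq]
    have := Nat.div_add_mod' d (rtB n)
    omega
  · rintro h i ⟨p, hp⟩
    have := congrArg Fin.val hp
    simp only [val_blkEmb] at this
    rw [blkBase_eq] at this
    have := Nat.zero_le (i.val * rtB n)
    omega

/-- Re-indexing operations along maps that agree on the wires. [folklore] -/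
theorem RtOp.map_congr {α β : Type} {f g : α → β} {op : RtOp α} (h : ∀ w ∈ op.wires, f w = g w) : op.map f = op.map g := by
  cases op with
  | cl op =>
    cases op with
    | not i => simp [RtOp.map, ClOp.map, h i (by simp [RtOp.wires, wiresOf, ClOp.target])]
    | cnot i j => simp [RtOp.map, ClOp.map, h i (by simp [RtOp.wires, wiresOf, ClOp.controls]), h j (by simp [RtOp.wires, wiresOf, ClOp.target])]
    | toffoli a b c =>
      simp [RtOp.map, ClOp.map, h a (by simp [RtOp.wires, wiresOf, ClOp.controls]), h b (by simp [RtOp.wires, wiresOf, ClOp.controls]),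
        h c (by simp [RtOp.wires, wiresOf, ClOp.target])]
  | had a => simp [RtOp.map, h a (by simp [RtOp.wires])]
  | chad c a => simp [RtOp.map, h c (by simp [RtOp.wires]), h a (by simp [RtOp.wires])]
  | oracle qs t =>
    simp only [RtOp.map, RtOp.oracle.injEq]
    exact ⟨List.map_congr_left fun w hw => h w (by simp [RtOp.wires, hw]), h t (by simp [RtOp.wires])⟩

/-- **The shifted block program through `foW` is the local block program through the block embedding.** [folklore] -/
theorem blockOps_map_shift (i : Fin (rtBlocks n)) :
    ((blockOps n (rtL n) i).map (RtOp.map (· + blkBase n i))).map (RtOp.map (foW n)) =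
      ((blockOps n (rtL n) i).map (RtOp.map (foB n (rtL n)))).map (RtOp.map (blkEmb n i)) := by
  rw [List.map_map, List.map_map]
  refine List.map_congr_left fun op hop => ?_
  simp only [Function.comp_apply, RtOp.map_map]
  refine RtOp.map_congr fun w hw => Fin.ext ?_
  have hwB : w < rtB n := blockOps_lt (le_of_lt i.isLt) op hop w hw
  simp only [Function.comp_apply, foW, val_blkEmb, foB, val_finOf_of_lt _ hwB,
    val_finOf_of_lt _ (show w + blkBase n i < rtW n by rw [add_comm]; exact blkBase_add_lt i.isLt hwB)]
  ring

/-- **The compiled blocks segment is the concatenation of the embedded block circuits.** [folklore] -/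
theorem compileList_blocksOps (h : ∀ op ∈ (blocksOps n).map (RtOp.map (foW n)), op.WF) :
    RtOp.compileList ((blocksOps n).map (RtOp.map (foW n))) h =
      (List.finRange (rtBlocks n)).flatMap fun i => (mapWires (blkEmb n i) (Qloc n (rtL n) i)).gates := by
  have hsplit : (blocksOps n).map (RtOp.map (foW n)) = (List.finRange (rtBlocks n)).flatMap fun i : Fin (rtBlocks n) =>
      ((blockOps n (rtL n) i.val).map (RtOp.map (foB n (rtL n)))).map (RtOp.map (blkEmb n i)) := by
    rw [blocksOps, List.map_flatMap, range_eq_map_finRange, List.flatMap_map]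
    congr 1
    funext i
    exact blockOps_map_shift i
  rw [RtOp.compileList_congr hsplit h (fun op hop => h op (hsplit ▸ hop))]
  -- by induction over the list of blocks
  suffices key : ∀ (l : List (Fin (rtBlocks n))) (hl : ∀ op ∈ l.flatMap (fun i : Fin (rtBlocks n) =>
      ((blockOps n (rtL n) i.val).map (RtOp.map (foB n (rtL n)))).map (RtOp.map (blkEmb n i))), op.WF),
      RtOp.compileList _ hl = l.flatMap fun i => (mapWires (blkEmb n i) (Qloc n (rtL n) i)).gates from key _ _
  intro l hl
  induction l with
  | nil => rfl
  | cons i l ih =>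
    conv_rhs => rw [List.flatMap_cons]
    rw [RtOp.compileList_congr List.flatMap_cons hl (fun op hop => hl op (by rw [List.flatMap_cons]; exact hop)),
      RtOp.compileList_append, ih]
    congr 1
    rw [← RtOp.compileList_map_embed (blkEmb n i) ((blockOps n (rtL n) i).map (RtOp.map (foB n (rtL n))))
      (wf_map_finOf_of (Bsz_pos _ _) (blockOps_wf (n := n) (L := rtL n) i) (blockOps_lt (le_of_lt i.isLt)))]
    rfl

end Blocks

/-! ### The acceptance probability of the big circuit -/

section Accept

variable {n : ℕ} (A : Language Bool)

/-- The state after the pre-processing: `clEval preOps` of the padded input, on `Fin (rtW n)`. [folklore] -/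
def zPre (x : QReg n) : QReg (rtW n) := fun p => clEval (preOps n) (liftW (padInput x (rtAnc n))) p

/-- The padded input vanishes from wire `n` on. [folklore] -/
theorem liftW_padInput_of_le (x : QReg n) {p : ℕ} (hp : n ≤ p) : liftW (padInput x (rtAnc n)) p = false := by
  unfold liftW
  split
  · rename_i h
    unfold padInput
    rw [show (⟨p, h⟩ : Fin (rtW n)) = Fin.natAdd n ⟨p - n, Nat.sub_lt_left_of_lt_add hp h⟩ from Fin.ext (by simp; omega),
      Fin.append_right]
  · rfl

/-- **The pre-processing state**: `0` on wire `0`, `1` on the token start, the old wire `0` on the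
junk wire, the padded input elsewhere. [folklore] -/
theorem zPre_apply (x : QReg n) (p : Fin (rtW n)) :
    zPre x p = if (p : ℕ) = 0 then false else if (p : ℕ) = n + 1 then liftW (padInput x (rtAnc n)) 0
      else if (p : ℕ) = uW n 0 0 then true else liftW (padInput x (rtAnc n)) p :=
  clEval_preOps _ (fun _ hq => liftW_padInput_of_le x hq) p

/-- The pre-processing state vanishes from `n + 2` on, except on the token start. [folklore] -/
theorem zPre_of_le (x : QReg n) (p : Fin (rtW n)) (hp : n + 2 ≤ (p : ℕ)) (hp' : (p : ℕ) ≠ uW n 0 0) : zPre x p = false := by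
  rw [zPre_apply, if_neg (by omega), if_neg (by omega), if_neg hp', liftW_padInput_of_le x (by omega)]

/-- The compiled pre-processing maps the padded input to `zPre`. [folklore] -/
theorem pre_mulVec (x : QReg n) (h : ∀ op ∈ ((preOps n).map (ClOp.map (foW n))).map RtOp.cl, op.WF) :
    (⟨RtOp.compileList (((preOps n).map (ClOp.map (foW n))).map RtOp.cl) h⟩ : QCircuit cliffordT (rtW n)).toMatrix A *ᵥ
      basisState (padInput x (rtAnc n)) = basisState (zPre x) := by
  rw [compileList_map_cl_mulVec_basisState]
  congr 1
  funext p
  rw [foW, clEval_map_finOf_apply rtW_pos _ (fun op hop w hw => preOps_lt op hop w hw)]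
  rfl

/-- The block states: the block circuits run on `|0…0⟩`. [cite: RazTalJACM2022, App. A] -/
def blockState (i : Fin (rtBlocks n)) : QReg (rtB n) → ℂ := (Qloc n (rtL n) i).toMatrix A *ᵥ basisState fun _ => false

/-- **The state after the blocks** is the product state of the block states over `zPre`.
[cite: NielsenChuang2010, §2.1.7 eq. (2.45)] -/
theorem blocks_mulVec (x : QReg n) (h : ∀ op ∈ (blocksOps n).map (RtOp.map (foW n)), op.WF) :
    (⟨RtOp.compileList ((blocksOps n).map (RtOp.map (foW n))) h⟩ : QCircuit cliffordT (rtW n)).toMatrix A *ᵥ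
      basisState (zPre x) = prodState (blkEmb n) (blockState A) (zPre x) := by
  have hz : ∀ i : Fin (rtBlocks n), zPre x ∘ blkEmb n i = fun _ => false := by
    intro i; funext p
    simp only [Function.comp_apply]
    refine zPre_of_le x _ (by simp; have := le_blkBase (n := n) i; omega) fun h' => ?_
    have := uW_lt_blkBase (n := n) (Nat.zero_le _) (Nat.zero_le _) i
    simp at h'; omega
  rw [compileList_blocksOps, basisState_eq_prodState (blkEmb n) (zPre x)]
  simp only [hz]
  exact toMatrix_flatMap_mapWires_mulVec_prodState A blockDisjoint_blkEmb (Qloc n (rtL n)) _ _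

/-- The compiled post-processing permutes the basis states by `clEval`. [folklore] -/
theorem post_mulVec_basisState (h : ∀ op ∈ ((postOps n).map (ClOp.map (foW n))).map RtOp.cl, op.WF) (z : QReg (rtW n)) :
    (⟨RtOp.compileList (((postOps n).map (ClOp.map (foW n))).map RtOp.cl) h⟩ : QCircuit cliffordT (rtW n)).toMatrix A *ᵥ
      basisState z = basisState (clEval ((postOps n).map (ClOp.map (foW n))) z) :=
  compileList_map_cl_mulVec_basisState A _ h z

/-- The post-processing permutation is injective. [folklore] -/
theorem post_injective : Function.Injective (clEval ((postOps n).map (ClOp.map (foW n)))) :=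
  clEval_injective _ fun op hop => by
    obtain ⟨op', hop', rfl⟩ := List.mem_map.1 hop
    exact wf_map_finOf rtW_pos (postOps_lt op' hop') (postOps_wf op' hop')

/-- Reading an assignment of `Fin N` below `N` through `liftW`. [folklore] -/
theorem liftW_of_lt {N : ℕ} (z : QReg N) {p : ℕ} (hp : p < N) : liftW z p = z ⟨p, hp⟩ := dif_pos hp

/-- The half selector of block `i` through the block embedding. [folklore] -/
theorem blkEmb_fh (i : Fin (rtBlocks n)) : blkEmb n i (fh n (rtL n)) = ⟨hGlob n i, hGlob_lt i.isLt⟩ :=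
  Fin.ext (by simp [hGlob, hW])

/-- **The post-processing on the support of the product state**: wire `0` receives the threshold
bit of the number of accepting blocks. [cite: RazTalJACM2022, Claim 8.1] -/
theorem post_zero (x : QReg n) (z : QReg (rtW n)) (hz : ∀ w, OffBlocks (blkEmb n) w → z w = zPre x w) :
    clEval ((postOps n).map (ClOp.map (foW n))) z ⟨0, rtW_pos⟩ =
      decide (rtThreshold n ≤ (Finset.univ.filter fun i : Fin (rtBlocks n) => z (blkEmb n i (fh n (rtL n))) = false).card) := by
  have hoff : ∀ p : Fin (rtW n), (p : ℕ) < blkBase n 0 → z p = zPre x p := fun p hp => hz p ((offBlocks_iff p).2 hp)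
  have hu0 := uW_lt_blkBase (n := n) (Nat.zero_le _) (Nat.zero_le _) 0
  rw [foW, clEval_map_finOf_apply rtW_pos _ (fun op hop w hw => postOps_lt op hop w hw),
    clEval_postOps_zero (n := n) (liftW z)]
  · congr 2
    have e : (Finset.range (rtBlocks n)).filter (fun i => liftW z (hGlob n i) = false) =
        (Finset.univ.filter fun i : Fin (rtBlocks n) => z (blkEmb n i (fh n (rtL n))) = false).map Fin.valEmbedding := by
      ext i
      simp only [Finset.mem_filter, Finset.mem_range, Finset.mem_map, Finset.mem_univ, true_and, Fin.valEmbedding_apply]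
      constructor
      · rintro ⟨hi, h⟩
        refine ⟨⟨i, hi⟩, ?_, rfl⟩
        rwa [blkEmb_fh, ← liftW_of_lt z (hGlob_lt hi)]
      · rintro ⟨j, hj, rfl⟩
        refine ⟨j.isLt, ?_⟩
        rwa [liftW_of_lt z (hGlob_lt j.isLt), ← blkEmb_fh]
    unfold cnt
    rw [e, Finset.card_map]
  · rw [liftW_of_lt z rtW_pos, hoff _ (by simp; have := le_blkBase (n := n) 0; omega), zPre_apply, if_pos rfl]
  · rw [liftW_of_lt z (uW_lt_rtW (Nat.zero_le _) (Nat.zero_le _)), hoff _ hu0, zPre_apply,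
      if_neg (by have := le_uW (n := n) 0 0; simp; omega), if_neg (by have := le_uW (n := n) 0 0; simp; omega), if_pos rfl]
  · intro s c hs hc hsc
    rw [liftW_of_lt z (uW_lt_rtW hs hc), hoff _ (uW_lt_blkBase hs hc 0), zPre_of_le x _ (le_uW s c)]
    intro h
    have := uW_inj hc (Nat.zero_le _) h
    exact hsc (by simp [this.1, this.2])

/-- The Born weight of half selector `b` in block `i`. [cite: RazTalJACM2022, §6] -/
theorem blockState_weight (i : Fin (rtBlocks n)) (b : Bool) :
    (∑ v : QReg (rtB n), if v (fh n (rtL n)) = b then ‖blockState A i v‖ ^ 2 else 0) =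
      if b then 1 - blockAcc n (rtWindow A n i) else blockAcc n (rtWindow A n i) := by
  rw [blockState, sum_ite_normSq_Qloc]
  rfl

/-- Patterns of accepting blocks as Boolean functions and as finsets. [folklore] -/
def patternEquiv (m : ℕ) : (Fin m → Bool) ≃ Finset (Fin m) where
  toFun b := Finset.univ.filter fun i => b i = false
  invFun S := fun i => decide (i ∉ S)
  left_inv b := by funext i; cases h : b i <;> simp [h]
  right_inv S := by ext i; simp

/-- **The acceptance probability of the big circuit is `q1Accept`** (Raz–Tal App. A with Claim 8.1:
the `m` runs are independent, run `i` accepts with probability `blockAcc n (x_n i)`, and the machine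
accepts iff at least `rtThreshold n` runs accept). [cite: RazTalJACM2022, App. A and Claim 8.1] -/
theorem acceptProb_bigCirc (x : QReg n) : (bigCirc n).acceptProb A x = q1Accept n (rtWindow A n) := by
  classical
  -- split the program
  have hsplit : (allOps n).map (RtOp.map (foW n)) =
      ((preOps n).map (ClOp.map (foW n))).map RtOp.cl ++ ((blocksOps n).map (RtOp.map (foW n)) ++
        ((postOps n).map (ClOp.map (foW n))).map RtOp.cl) := by
    simp [allOps, List.map_map, Function.comp_def, RtOp.map]
  unfold QCircuit.acceptProb
  simp only [rtW_pos, dif_pos, QCircuit.runOn]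
  unfold bigCirc
  rw [RtOp.compileList_congr hsplit _ (fun op hop => (wf_map_finOf_of rtW_pos allOps_wf allOps_lt) op (hsplit ▸ hop)),
    RtOp.compileList_append, RtOp.compileList_append, toMatrix_mk_append, toMatrix_mk_append, Matrix.mul_assoc,
    ← Matrix.mulVec_mulVec, ← Matrix.mulVec_mulVec, pre_mulVec, blocks_mulVec]
  -- the post-processing permutes the Born weights
  rw [sum_ite_normSq_mulVec_of_perm ⟨_, post_injective⟩ (post_mulVec_basisState A _) _ (fun y => y ⟨0, rtW_pos⟩ = true)]
  simp only [Function.Embedding.coeFn_mk]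
  -- on the support, wire `0` is the threshold bit of the accept pattern
  set Ψ := prodState (blkEmb n) (blockState A) (zPre x) with hΨ
  set g : (Fin (rtBlocks n) → QReg (rtB n)) → ℝ := fun y =>
    if rtThreshold n ≤ (Finset.univ.filter fun i => y i (fh n (rtL n)) = false).card then 1 else 0 with hg
  have hsupp : ∀ z, (if clEval ((postOps n).map (ClOp.map (foW n))) z ⟨0, rtW_pos⟩ = true then ‖Ψ z‖ ^ 2 else 0) =
      ‖Ψ z‖ ^ 2 * g (fun i => z ∘ blkEmb n i) := by
    intro z
    by_cases hz : ∀ w, OffBlocks (blkEmb n) w → z w = zPre x w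
    · rw [post_zero x z hz, hg]
      simp only [Function.comp_apply, decide_eq_true_eq]
      split <;> simp
    · have h0 : Ψ z = 0 := by rw [hΨ, prodState_apply, if_neg hz, zero_mul]
      simp [h0]
  simp_rw [hsupp]
  rw [sum_normSq_prodState_mul blockDisjoint_blkEmb]
  -- regroup by the accept pattern
  have hreg : ∀ y : Fin (rtBlocks n) → QReg (rtB n), (∏ i, ‖blockState A i (y i)‖ ^ 2) * g y =
      ∑ b : Fin (rtBlocks n) → Bool, (if rtThreshold n ≤ (Finset.univ.filter fun i => b i = false).card then (1 : ℝ) else 0) *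
        ∏ i, (if y i (fh n (rtL n)) = b i then ‖blockState A i (y i)‖ ^ 2 else 0) := by
    intro y
    rw [Finset.sum_eq_single (fun i => y i (fh n (rtL n)))]
    · rw [hg, mul_comm]
      simp
    · intro b _ hb
      rw [Finset.prod_ite_zero, if_neg (fun h : ∀ i ∈ Finset.univ, y i (fh n (rtL n)) = b i =>
        hb (funext fun i => (h i (Finset.mem_univ i)).symm)), mul_zero]
    · intro h; exact absurd (Finset.mem_univ _) h
  simp_rw [hreg]
  rw [Finset.sum_comm]
  simp_rw [← Finset.mul_sum]
  have hprod : ∀ b : Fin (rtBlocks n) → Bool,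
      (∑ y : Fin (rtBlocks n) → QReg (rtB n), ∏ i, (if y i (fh n (rtL n)) = b i then ‖blockState A i (y i)‖ ^ 2 else 0)) =
        ∏ i, (if b i then 1 - blockAcc n (rtWindow A n i) else blockAcc n (rtWindow A n i)) := by
    intro b
    have := Finset.prod_univ_sum (fun _ : Fin (rtBlocks n) => (Finset.univ : Finset (QReg (rtB n))))
      (fun i v => if v (fh n (rtL n)) = b i then ‖blockState A i v‖ ^ 2 else 0)
    rw [Fintype.piFinset_univ] at this
    rw [← this]
    exact Finset.prod_congr rfl fun i _ => blockState_weight A i (b i)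
  simp_rw [hprod]
  -- compare with `q1Accept`
  unfold q1Accept runPattern
  rw [← Fintype.sum_equiv (patternEquiv (rtBlocks n)) _ _ (fun b => rfl)]
  refine Finset.sum_congr rfl fun b _ => ?_
  simp only [patternEquiv, Equiv.coe_fn_mk, Finset.mem_filter, Finset.mem_univ, true_and]
  split
  · rw [one_mul]
    refine Finset.prod_congr rfl fun i _ => ?_
    cases b i <;> simp
  · rw [zero_mul]

end Accept

/-! ### The hard-wired lengths, the family, and `RazTal2022_bqpMachine` from uniformity -/

section Family

variable (n : ℕ)

/-- The program of the hard-wired lengths: clear wire `0` into the junk wire, then set it to `b`.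
[cite: RazTalJACM2022, App. A ("we may hardwire the values of L on 1ⁿ for n < n₀")] -/
def smallOps (b : Bool) : List (ClOp ℕ) :=
  if b then [ClOp.cnot 0 (n + 1), ClOp.cnot (n + 1) 0, ClOp.not 0] else [ClOp.cnot 0 (n + 1), ClOp.cnot (n + 1) 0]

variable {n}

/-- The hard-wired program is well formed. [folklore] -/
theorem smallOps_wf (b : Bool) : ∀ op ∈ smallOps n b, op.WF := by
  intro op hop
  have h1 : (ClOp.cnot 0 (n + 1)).WF := show (0 : ℕ) ≠ n + 1 by omega
  have h2 : (ClOp.cnot (n + 1) 0).WF := show n + 1 ≠ 0 by omega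
  cases b <;> simp only [smallOps, Bool.false_eq_true, ↓reduceIte, List.mem_cons, List.not_mem_nil, or_false] at hop
  · rcases hop with rfl | rfl
    · exact h1
    · exact h2
  · rcases hop with rfl | rfl | rfl
    · exact h1
    · exact h2
    · trivial

/-- The wires of the hard-wired program. [folklore] -/
theorem smallOps_lt (b : Bool) : ∀ op ∈ (smallOps n b).map RtOp.cl, ∀ w ∈ op.wires, w < rtW n := by
  intro op hop w hw
  obtain ⟨op', hop', rfl⟩ := List.mem_map.1 hop
  have hW : n + 1 < rtW n := by unfold rtW rtAnc; omega
  have key : op' = ClOp.cnot 0 (n + 1) ∨ op' = ClOp.cnot (n + 1) 0 ∨ op' = ClOp.not 0 := by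
    cases b <;> simp only [smallOps, Bool.false_eq_true, ↓reduceIte, List.mem_cons, List.not_mem_nil, or_false] at hop' <;> tauto
  rcases key with rfl | rfl | rfl <;>
    simp only [RtOp.wires, mem_wiresOf, ClOp.target, ClOp.controls, List.mem_singleton, List.not_mem_nil, or_false] at hw <;>
    omega

variable (n)

/-- **The hard-wired circuit** accepting with probability `b`. [cite: RazTalJACM2022, App. A] -/
def smallCirc (b : Bool) : QCircuit cliffordT (rtW n) :=
  ⟨RtOp.compileList (((smallOps n b).map RtOp.cl).map (RtOp.map (foW n)))
    (wf_map_finOf_of rtW_pos (fun op hop => by obtain ⟨op', hop', rfl⟩ := List.mem_map.1 hop; exact smallOps_wf b op' hop')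
      (smallOps_lt b))⟩

variable {n}

/-- **The hard-wired circuit accepts with probability exactly `b`.** [cite: RazTalJACM2022, App. A] -/
theorem acceptProb_smallCirc (A : Language Bool) (b : Bool) (x : QReg n) :
    (smallCirc n b).acceptProb A x = if b then 1 else 0 := by
  have hmap : ((smallOps n b).map RtOp.cl).map (RtOp.map (foW n)) = ((smallOps n b).map (ClOp.map (foW n))).map RtOp.cl := by
    simp [List.map_map, Function.comp_def, RtOp.map]
  have hrun : (smallCirc n b).runOn A (basisState (padInput x (rtAnc n))) =
      basisState (clEval ((smallOps n b).map (ClOp.map (foW n))) (padInput x (rtAnc n))) := by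
    rw [QCircuit.runOn, smallCirc, RtOp.compileList_congr hmap _ (fun op hop => by
      obtain ⟨op₁, hop₁, rfl⟩ := List.mem_map.1 hop
      obtain ⟨op₂, hop₂, rfl⟩ := List.mem_map.1 hop₁
      exact wf_map_finOf rtW_pos (fun w hw => smallOps_lt b (RtOp.cl op₂) (List.mem_map.2 ⟨op₂, hop₂, rfl⟩) w hw)
        (smallOps_wf b op₂ hop₂)), compileList_map_cl_mulVec_basisState]
  rw [QCircuit.acceptProb_of_runOn_eq_basisState A _ x _ rtW_pos hrun, foW,
    clEval_map_finOf_apply rtW_pos _ (fun op hop w hw => smallOps_lt b (RtOp.cl op) (List.mem_map.2 ⟨op, hop, rfl⟩) w hw)]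
  have hw : ∀ p, n ≤ p → liftW (padInput x (rtAnc n)) p = false := fun p hp => liftW_padInput_of_le x hp
  have hpre : ∀ w : ℕ → Bool, w (n + 1) = false → clEval [ClOp.cnot 0 (n + 1), ClOp.cnot (n + 1) 0] w 0 = false := by
    intro w hw1
    simp only [clEval_cons, clEval_nil, ClOp.eval_cnot]
    rw [Function.update_self, Function.update_of_ne (show (0 : ℕ) ≠ n + 1 by omega), Function.update_self, hw1]
    cases w 0 <;> rfl
  change (if clEval (smallOps n b) (liftW (padInput x (rtAnc n))) 0 = true then (1 : ℝ) else 0) = _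
  cases b
  · simp only [smallOps, Bool.false_eq_true, ↓reduceIte]
    rw [hpre _ (hw _ (by omega))]; simp
  · simp only [smallOps, ↓reduceIte]
    rw [show [ClOp.cnot 0 (n + 1), ClOp.cnot (n + 1) 0, ClOp.not 0] = [ClOp.cnot 0 (n + 1), ClOp.cnot (n + 1) 0] ++ [ClOp.not 0]
      from rfl, clEval_append, clEval_cons, clEval_nil, ClOp.eval_not, Function.update_self, hpre _ (hw _ (by omega))]
    simp

variable (n)

/-- **The Raz–Tal family** with threshold `n₀` and table `tbl`: the hard-wired circuit below `n₀`, the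
big circuit from `n₀` on; `rtAnc n` ancillas in both cases (the hard-wired circuit only uses wires
`0` and `n + 1`). [cite: RazTalJACM2022, App. A] -/
def rtFamily (n₀ : ℕ) (tbl : ℕ → Bool) : QCircuitFamily cliffordT :=
  ⟨rtAnc, fun n => if n < n₀ then smallCirc n (tbl n) else bigCirc n⟩

variable {n}

/-- Below `n₀` the family accepts with probability `tbl |x|`. [cite: RazTalJACM2022, App. A] -/
theorem acceptProbOn_rtFamily_of_lt (n₀ : ℕ) (tbl : ℕ → Bool) (A : Language Bool) (x : List Bool) (hx : x.length < n₀) :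
    (rtFamily n₀ tbl).acceptProbOn A x = if tbl x.length then 1 else 0 := by
  unfold QCircuitFamily.acceptProbOn rtFamily
  simp only [hx, ↓reduceIte]
  exact acceptProb_smallCirc A (tbl x.length) x.get

/-- From `n₀` on the family accepts with probability `q1Accept |x| (x_{|x|})`. [cite: RazTalJACM2022, App. A and Claim 8.1] -/
theorem acceptProbOn_rtFamily_of_le (n₀ : ℕ) (tbl : ℕ → Bool) (A : Language Bool) (x : List Bool) (hx : n₀ ≤ x.length) :
    (rtFamily n₀ tbl).acceptProbOn A x = q1Accept x.length (rtWindow A x.length) := by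
  unfold QCircuitFamily.acceptProbOn rtFamily
  simp only [not_lt.2 hx, ↓reduceIte]
  exact acceptProb_bigCirc A x.get

/-- **`RazTal2022_bqpMachine` from the uniformity of the family.** Given that every `rtFamily n₀ tbl` is
polynomial-time uniform (`RazTalMachineUniform.lean`), the named fact `RazTal2022_bqpMachine` of
`OracleSeparationBQPPH.lean` holds: the family accepts with probability `tbl |x|` below `n₀` and
`q1Accept |x| (x_{|x|})` from `n₀` on. [cite: RazTalJACM2022, App. A] -/
theorem razTal2022_bqpMachine_of_isUniform (hU : ∀ (n₀ : ℕ) (tbl : ℕ → Bool), (rtFamily n₀ tbl).IsUniform) :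
    RazTal2022_bqpMachine := fun n₀ tbl =>
  ⟨rtFamily n₀ tbl, hU n₀ tbl, fun A x =>
    ⟨fun hx => acceptProbOn_rtFamily_of_lt n₀ tbl A x hx, fun hx => acceptProbOn_rtFamily_of_le n₀ tbl A x hx⟩⟩

end Family

end RazTalMachine

end Literature.Computability.QuantumComplexity
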